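import Literature.Geometry.Lorentzian.NearFramedChart
import Literature.Geometry.Lorentzian.KerrSchildCoord
import HarnessLib

/-!
# The Kerr–Schild frame: Kerr is exactly Minkowski when read in it

The linear maps `A(x) v = v + H(x) ℓ(v) ℓ♯` and `A(x)⁻¹ v = v − H(x) ℓ(v) ℓ♯` (`ℓ` the Kerr–Schild null
covector, `ℓ♯` its `η`-dual, `H = Mr³/(r⁴ + a²z²)`) are mutually inverse (`ℓ(ℓ♯) = 0`) and satisfy
`η(A v, A w) = η(v, w) + 2H ℓ(v) ℓ(w) = g_{M,a}(v, w)`: the Kerr–Schild metric is the Minkowski form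
read in the frame `A`, and conversely `g_{M,a}` read in `A⁻¹` is EXACTLY `η`
(`framedBilin_bilin_ksFrame_Ainv`). Packaged as a `FrameField (Kerr.region a r₀)`
(`Kerr.ksFrame`; smooth with smooth inverse since `H, ℓ, ℓ♯` are smooth where `r > 0`), this is
the frame in which nearness to Kerr is measured by the framed local Cheeger–Gromov compactness
theorem (`TameChartCompactnessFramed.lean`): metrics uniformly close to Kerr–Schild Kerr on any
`Kerr.region a r₀` — down to and across the horizon — have framed deviations close to `0`.

## References
* R. P. Kerr, A. Schild, 1965, §3; M. Visser, arXiv:0706.0622, (32)–(35). [KerrSchild1965] [arXiv07060622]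
-/

noncomputable section

open Set Filter TopologicalSpace Function
open scoped Manifold ContDiff Topology

namespace Literature.Geometry.Lorentzian.Kerr

/-- The rank-one map `v ↦ ℓ(v) ℓ♯`. [cite: KerrSchild1965, §3] -/
def ellTensor (a : ℝ) (x : E4) : E4 →L[ℝ] E4 := (nullCovector a x).smulRight (nullVector a x)

/-- Unfolding lemma. [folklore] -/
@[simp]
theorem ellTensor_apply (a : ℝ) (x v : E4) : ellTensor a x v = nullCovector a x v • nullVector a x := rfl

/-- `(ℓ ⊗ ℓ♯)² = 0` where `r > 0` (`ℓ(ℓ♯) = 0`). [cite: KerrSchild1965, §3] -/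
theorem ellTensor_ellTensor {a : ℝ} {x : E4} (hx : 0 < radius a x) (v : E4) :
    ellTensor a x (ellTensor a x v) = 0 := by
  simp [ellTensor_apply, nullCovector_nullVector hx]

/-- **The Kerr–Schild frame** `A(x) v = v + H(x) ℓ(v) ℓ♯`. [cite: KerrSchild1965, §3] -/
def ksFrameMap (M a : ℝ) (x : E4) : E4 →L[ℝ] E4 :=
  ContinuousLinearMap.id ℝ E4 + scalarH M a x • ellTensor a x

/-- **Its inverse** `A(x)⁻¹ v = v − H(x) ℓ(v) ℓ♯`. [cite: KerrSchild1965, §3] -/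
def ksFrameInvMap (M a : ℝ) (x : E4) : E4 →L[ℝ] E4 :=
  ContinuousLinearMap.id ℝ E4 - scalarH M a x • ellTensor a x

/-- Unfolding lemma. [folklore] -/
theorem ksFrameMap_apply (M a : ℝ) (x v : E4) :
    ksFrameMap M a x v = v + scalarH M a x • (nullCovector a x v • nullVector a x) := rfl

/-- Unfolding lemma. [folklore] -/
theorem ksFrameInvMap_apply (M a : ℝ) (x v : E4) :
    ksFrameInvMap M a x v = v - scalarH M a x • (nullCovector a x v • nullVector a x) := rfl

/-- `A ∘ A⁻¹ = id` where `r > 0`. [cite: KerrSchild1965, §3] -/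
theorem ksFrameMap_comp_ksFrameInvMap (M a : ℝ) {x : E4} (hx : 0 < radius a x) :
    (ksFrameMap M a x).comp (ksFrameInvMap M a x) = ContinuousLinearMap.id ℝ E4 := by
  refine ContinuousLinearMap.ext fun v ↦ ?_
  have h0 := nullCovector_nullVector hx (a := a)
  simp only [ContinuousLinearMap.coe_comp, comp_apply, ksFrameInvMap_apply, ksFrameMap_apply,
    map_sub, map_smul, h0, zero_smul, smul_zero, ContinuousLinearMap.id_apply]
  abel

/-- `A⁻¹ ∘ A = id` where `r > 0`. [cite: KerrSchild1965, §3] -/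
theorem ksFrameInvMap_comp_ksFrameMap (M a : ℝ) {x : E4} (hx : 0 < radius a x) :
    (ksFrameInvMap M a x).comp (ksFrameMap M a x) = ContinuousLinearMap.id ℝ E4 := by
  refine ContinuousLinearMap.ext fun v ↦ ?_
  have h0 := nullCovector_nullVector hx (a := a)
  simp only [ContinuousLinearMap.coe_comp, comp_apply, ksFrameInvMap_apply, ksFrameMap_apply,
    map_add, map_smul, h0, zero_smul, smul_zero, ContinuousLinearMap.id_apply]
  abel

/-- **`η` read in the Kerr–Schild frame is the Kerr–Schild metric**: `η(A v, A w) = g_{M,a}(v, w)`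
where `r > 0`. [cite: KerrSchild1965, §3] -/
theorem minkowski_ksFrameMap (M a : ℝ) {x : E4} (hx : 0 < radius a x) (v w : E4) :
    Minkowski.bilin (ksFrameMap M a x v) (ksFrameMap M a x w) = bilin M a x v w := by
  have h0 : Minkowski.bilin (nullVector a x) (nullVector a x) = 0 := by
    rw [bilin_nullVector]; exact nullCovector_nullVector hx
  simp only [ksFrameMap_apply, map_add, map_smul, add_apply, FunLike.coe_smul, Pi.smul_apply,
    smul_eq_mul, bilin_nullVector, bilin_nullVector_right, h0, bilin_apply]
  ring

/-- **The Kerr–Schild metric read in `A⁻¹` is exactly `η`**: `g_{M,a}(A⁻¹ v, A⁻¹ w) = η(v, w)`.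
[cite: KerrSchild1965, §3] -/
theorem bilin_ksFrameInvMap (M a : ℝ) {x : E4} (hx : 0 < radius a x) (v w : E4) :
    bilin M a x (ksFrameInvMap M a x v) (ksFrameInvMap M a x w) = Minkowski.bilin v w := by
  have h1 := minkowski_ksFrameMap M a hx (ksFrameInvMap M a x v) (ksFrameInvMap M a x w)
  have hv : ksFrameMap M a x (ksFrameInvMap M a x v) = v := by
    simpa using DFunLike.congr_fun (ksFrameMap_comp_ksFrameInvMap M a hx) v
  have hw : ksFrameMap M a x (ksFrameInvMap M a x w) = w := by
    simpa using DFunLike.congr_fun (ksFrameMap_comp_ksFrameInvMap M a hx) w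
  rw [hv, hw] at h1
  exact h1.symm

/-- Smoothness of `x ↦ ℓ ⊗ ℓ♯` where `r > 0`. [cite: arXiv07060622, (34)] -/
theorem contDiffAt_ellTensor (a : ℝ) {x : E4} (hx : 0 < radius a x) {n : WithTop ℕ∞} :
    ContDiffAt ℝ n (ellTensor a) x :=
  (contDiffAt_nullCovector a hx).smulRight (contDiffAt_nullVector a hx)

/-- Smoothness of the Kerr–Schild frame where `r > 0`. [cite: arXiv07060622, (33)–(35)] -/
theorem contDiffAt_ksFrameMap (M a : ℝ) {x : E4} (hx : 0 < radius a x) {n : WithTop ℕ∞} :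
    ContDiffAt ℝ n (ksFrameMap M a) x :=
  contDiffAt_const.add ((contDiffAt_scalarH M a hx).smul (contDiffAt_ellTensor a hx))

/-- Smoothness of the inverse frame where `r > 0`. [cite: arXiv07060622, (33)–(35)] -/
theorem contDiffAt_ksFrameInvMap (M a : ℝ) {x : E4} (hx : 0 < radius a x) {n : WithTop ℕ∞} :
    ContDiffAt ℝ n (ksFrameInvMap M a) x :=
  contDiffAt_const.sub ((contDiffAt_scalarH M a hx).smul (contDiffAt_ellTensor a hx))

/-- **The Kerr–Schild frame field on the chart domain `Kerr.region a r₀`.** [cite: KerrSchild1965, §3] -/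
def ksFrame (M a r₀ : ℝ) : FrameField (region a r₀) where
  A := ksFrameMap M a
  Ainv := ksFrameInvMap M a
  contDiffOn_A _ hx := (contDiffAt_ksFrameMap M a (radius_pos_of_mem_region hx)).contDiffWithinAt
  contDiffOn_Ainv _ hx :=
    (contDiffAt_ksFrameInvMap M a (radius_pos_of_mem_region hx)).contDiffWithinAt
  comp_Ainv _ hx := ksFrameMap_comp_ksFrameInvMap M a (radius_pos_of_mem_region hx)
  Ainv_comp _ hx := ksFrameInvMap_comp_ksFrameMap M a (radius_pos_of_mem_region hx)

/-- **Kerr read in the inverse Kerr–Schild frame is exactly Minkowski** on `Kerr.region a r₀`: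
`framedBilin (g_{M,a}) A⁻¹ = η` — the framed deviation of the Kerr–Schild chart of Kerr vanishes.
[cite: KerrSchild1965, §3] -/
theorem framedBilin_bilin_ksFrame_Ainv (M a r₀ : ℝ) {x : E4} (hx : x ∈ region a r₀) :
    framedBilin (bilin M a) (ksFrame M a r₀).Ainv x = Minkowski.bilin := by
  ext v w
  exact bilin_ksFrameInvMap M a (radius_pos_of_mem_region hx) v w

/-- Conversely `η` read in the frame is Kerr: `framedBilin η A = g_{M,a}` on the region.
[cite: KerrSchild1965, §3] -/
theorem framedBilin_minkowski_ksFrame_A (M a r₀ : ℝ) {x : E4} (hx : x ∈ region a r₀) :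
    framedBilin (fun _ ↦ Minkowski.bilin) (ksFrame M a r₀).A x = bilin M a x := by
  ext v w
  exact minkowski_ksFrameMap M a (radius_pos_of_mem_region hx) v w

/-! ### Size of the Kerr–Schild frame on `Kerr.region a r₀` -/

/-- `Σ_μ ℓ_μ² = 2` where `r > 0` (Euclidean size of the null covector: `ℓ₀ = 1` and the spatial
part is a Euclidean unit vector, `Kerr.sum_sq_nullCovectorFun`). [cite: arXiv07060622, (34)–(35)] -/
theorem sum_univ_sq_nullCovectorFun {a : ℝ} {x : E4} (hx : 0 < radius a x) :
    ∑ μ, nullCovectorFun a x μ ^ 2 = 2 := by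
  have hf0 : nullCovectorFun a x 0 = 1 := by simp [nullCovectorFun]
  rw [Fin.sum_univ_four, hf0]
  linear_combination sum_sq_nullCovectorFun hx

/-- `‖ℓ♯‖² = 2` (Euclidean norm) where `r > 0`. [cite: arXiv07060622, (34)–(35)] -/
theorem norm_nullVector_sq {a : ℝ} {x : E4} (hx : 0 < radius a x) : ‖nullVector a x‖ ^ 2 = 2 := by
  rw [EuclideanSpace.real_norm_sq_eq, Fin.sum_univ_four, nullVector_apply_zero, nullVector_apply_one,
    nullVector_apply_two, nullVector_apply_three]
  linear_combination sum_sq_nullCovectorFun hx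

/-- `ℓ(v)² ≤ 2 ‖v‖²` (Cauchy–Schwarz) where `r > 0`. [folklore] -/
theorem sq_nullCovector_apply_le {a : ℝ} {x : E4} (hx : 0 < radius a x) (v : E4) :
    nullCovector a x v ^ 2 ≤ 2 * ‖v‖ ^ 2 := by
  rw [nullCovector, E4.covector_apply, EuclideanSpace.real_norm_sq_eq,
    ← sum_univ_sq_nullCovectorFun hx]
  exact Finset.sum_mul_sq_le_sq_mul_sq _ _ _

/-- `‖ℓ(v) ℓ♯‖ ≤ 2 ‖v‖` where `r > 0`. [folklore] -/
theorem norm_ellTensor_apply_le {a : ℝ} {x : E4} (hx : 0 < radius a x) (v : E4) :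
    ‖ellTensor a x v‖ ≤ 2 * ‖v‖ := by
  rw [ellTensor_apply, norm_smul, Real.norm_eq_abs]
  have hcs := sq_nullCovector_apply_le hx v (a := a)
  have hv2 := norm_nullVector_sq hx (a := a)
  have hnn : 0 ≤ |nullCovector a x v| * ‖nullVector a x‖ := by positivity
  rw [← pow_le_pow_iff_left₀ hnn (by positivity) two_ne_zero]
  calc (|nullCovector a x v| * ‖nullVector a x‖) ^ 2
      = nullCovector a x v ^ 2 * ‖nullVector a x‖ ^ 2 := by rw [mul_pow, sq_abs]
    _ ≤ 2 * ‖v‖ ^ 2 * 2 := mul_le_mul hcs hv2.le (by positivity) (by positivity)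
    _ = (2 * ‖v‖) ^ 2 := by ring

/-- `|H| ≤ |M| / r` where `r > 0` (drop `a²z² ≥ 0`; Visser arXiv:0706.0622, (33)). [folklore] -/
theorem abs_scalarH_le_div (M a : ℝ) {x : E4} (hx : 0 < radius a x) :
    |scalarH M a x| ≤ |M| / radius a x := by
  unfold scalarH
  have hr3 : 0 < radius a x ^ 3 := by positivity
  have hden : 0 < radius a x ^ 4 + a ^ 2 * x 3 ^ 2 := by positivity
  rw [abs_div, abs_mul, abs_of_pos hr3, abs_of_pos hden, div_le_div_iff₀ hden hx]
  nlinarith [mul_nonneg (abs_nonneg M) (sq_nonneg (a * x 3)), abs_nonneg M, hr3]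

/-- `|H| ≤ |M| / r₀` on `Kerr.region a r₀` for `r₀ > 0`. [folklore] -/
theorem abs_scalarH_le_of_mem_region (M : ℝ) {a r₀ : ℝ} (hr₀ : 0 < r₀) {x : E4}
    (hx : x ∈ (region a r₀ : Set E4)) : |scalarH M a x| ≤ |M| / r₀ :=
  (abs_scalarH_le_div M a (radius_pos_of_mem_region hx)).trans
    (div_le_div_of_nonneg_left (abs_nonneg M) hr₀ (lt_radius_of_mem_region hx).le)

/-- **`C⁰` size of the inverse Kerr–Schild frame**: `‖A(x)⁻¹‖ ≤ 1 + 2|M|/r₀` on `Kerr.region a r₀`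
(`r₀ > 0`). [cite: KerrSchild1965, §3] -/
theorem norm_ksFrameInvMap_le (M : ℝ) {a r₀ : ℝ} (hr₀ : 0 < r₀) {x : E4}
    (hx : x ∈ (region a r₀ : Set E4)) : ‖ksFrameInvMap M a x‖ ≤ 1 + 2 * |M| / r₀ := by
  have hH := abs_scalarH_le_of_mem_region M hr₀ hx
  have h0 : 0 ≤ 1 + 2 * |M| / r₀ := by positivity
  refine ContinuousLinearMap.opNorm_le_bound _ h0 fun v ↦ ?_
  rw [ksFrameInvMap_apply, ← ellTensor_apply]
  calc ‖v - scalarH M a x • ellTensor a x v‖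
      ≤ ‖v‖ + ‖scalarH M a x • ellTensor a x v‖ := norm_sub_le _ _
    _ = ‖v‖ + |scalarH M a x| * ‖ellTensor a x v‖ := by rw [norm_smul, Real.norm_eq_abs]
    _ ≤ ‖v‖ + |M| / r₀ * (2 * ‖v‖) := by
        gcongr
        exact norm_ellTensor_apply_le (radius_pos_of_mem_region hx) v
    _ = (1 + 2 * |M| / r₀) * ‖v‖ := by ring

/-- **`C⁰` size of the Kerr–Schild frame**: `‖A(x)‖ ≤ 1 + 2|M|/r₀` on `Kerr.region a r₀` (`r₀ > 0`).
[cite: KerrSchild1965, §3] -/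
theorem norm_ksFrameMap_le (M : ℝ) {a r₀ : ℝ} (hr₀ : 0 < r₀) {x : E4}
    (hx : x ∈ (region a r₀ : Set E4)) : ‖ksFrameMap M a x‖ ≤ 1 + 2 * |M| / r₀ := by
  have hH := abs_scalarH_le_of_mem_region M hr₀ hx
  have h0 : 0 ≤ 1 + 2 * |M| / r₀ := by positivity
  refine ContinuousLinearMap.opNorm_le_bound _ h0 fun v ↦ ?_
  rw [ksFrameMap_apply, ← ellTensor_apply]
  calc ‖v + scalarH M a x • ellTensor a x v‖
      ≤ ‖v‖ + ‖scalarH M a x • ellTensor a x v‖ := norm_add_le _ _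
    _ = ‖v‖ + |scalarH M a x| * ‖ellTensor a x v‖ := by rw [norm_smul, Real.norm_eq_abs]
    _ ≤ ‖v‖ + |M| / r₀ * (2 * ‖v‖) := by
        gcongr
        exact norm_ellTensor_apply_le (radius_pos_of_mem_region hx) v
    _ = (1 + 2 * |M| / r₀) * ‖v‖ := by ring

/-- The size bounds for the bundled frame field `Kerr.ksFrame`. [cite: KerrSchild1965, §3] -/
theorem norm_ksFrame_Ainv_le (M : ℝ) {a r₀ : ℝ} (hr₀ : 0 < r₀) {x : E4}
    (hx : x ∈ (region a r₀ : Set E4)) : ‖(ksFrame M a r₀).Ainv x‖ ≤ 1 + 2 * |M| / r₀ :=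
  norm_ksFrameInvMap_le M hr₀ hx

/-- The size bounds for the bundled frame field `Kerr.ksFrame`. [cite: KerrSchild1965, §3] -/
theorem norm_ksFrame_A_le (M : ℝ) {a r₀ : ℝ} (hr₀ : 0 < r₀) {x : E4}
    (hx : x ∈ (region a r₀ : Set E4)) : ‖(ksFrame M a r₀).A x‖ ≤ 1 + 2 * |M| / r₀ :=
  norm_ksFrameMap_le M hr₀ hx

/-! ### Orientation: `A⁻¹∂₀` is future-directed for Kerr (`M ≥ 0`) -/

/-- The `t*`-component of `A⁻¹∂₀ = ∂₀ − H ℓ♯` is `1 + H` (`(ℓ♯)⁰ = −1`). [cite: KerrSchild1965, §3] -/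
theorem ksFrameInvMap_basisVector_zero_apply_zero (M a : ℝ) (x : E4) :
    ksFrameInvMap M a x (E4.basisVector 0) 0 = 1 + scalarH M a x := by
  rw [ksFrameInvMap_apply, nullCovector_basisVector_zero, one_smul]
  simp [nullVector, nullCovectorFun]

/-- `g_{M,a}(V, A⁻¹∂₀) = −(1 + H)` for Kerr's orienting field `V = −g♯(dt*)` (`g(V, w) = −w⁰`).
[cite: arXiv08110354, §5.1] -/
theorem bilin_timeVector_ksFrameInvMap_basisVector_zero (M a : ℝ) {x : E4} (hx : 0 < radius a x) :
    bilin M a x (timeVector M a x) (ksFrameInvMap M a x (E4.basisVector 0)) = -(1 + scalarH M a x) := by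
  rw [bilin_timeVector hx, ksFrameInvMap_basisVector_zero_apply_zero]

/-- **`A⁻¹∂₀` is future-directed for Kerr's time orientation when `M ≥ 0`**:
`g(V, A⁻¹∂₀) = −(1 + H) < 0`. [cite: arXiv08110354, §5.1] -/
theorem bilin_timeVector_ksFrameInvMap_basisVector_zero_neg {M : ℝ} (hM : 0 ≤ M) (a : ℝ) {x : E4}
    (hx : 0 < radius a x) :
    bilin M a x (timeVector M a x) (ksFrameInvMap M a x (E4.basisVector 0)) < 0 := by
  rw [bilin_timeVector_ksFrameInvMap_basisVector_zero M a hx]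
  linarith [scalarH_nonneg hM a x]

/-- **`A⁻¹∂₀` is `g_{M,a}`-timelike everywhere on `{r > 0}`** — also inside the ergoregion, where
`∂₀` itself is spacelike: `g(A⁻¹∂₀, A⁻¹∂₀) = η(∂₀, ∂₀) = −1`. [cite: KerrSchild1965, §3] -/
theorem bilin_ksFrameInvMap_basisVector_zero_self (M a : ℝ) {x : E4} (hx : 0 < radius a x) :
    bilin M a x (ksFrameInvMap M a x (E4.basisVector 0)) (ksFrameInvMap M a x (E4.basisVector 0)) = -1 := by
  rw [bilin_ksFrameInvMap M a hx, Minkowski.bilin_basisVector_zero]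

/-- **In the Kerr spacetime `Kerr.spacetime M a r₀` (`M ≥ 0`), `A⁻¹∂₀` is future-directed** at every
point: the orientation hypothesis of the framed compactness theorems holds for the identity chart
of Kerr itself, and hence for charts whose orientation is compatible with Kerr's.
[cite: arXiv08110354, §5.1] -/
theorem isFutureDirected_ksFrame_Ainv_basisVector_zero [Facts] {M : ℝ} (hM : 0 ≤ M) (a r₀ : ℝ)
    (x : region a r₀) :
    (Kerr.spacetime M a r₀ hM).timeOrientation.IsFutureDirected (x := x)
      ((ksFrame M a r₀).Ainv x.1 (E4.basisVector 0)) := by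
  have hx := radius_pos_of_mem_region x.2
  refine ⟨LorentzianMetric.IsTimelike.isCausal (g := (Kerr.spacetime M a r₀ hM).metric) ?_, ?_⟩
  · show bilin M a x.1 (ksFrameInvMap M a x.1 (E4.basisVector 0))
      (ksFrameInvMap M a x.1 (E4.basisVector 0)) < 0
    rw [bilin_ksFrameInvMap_basisVector_zero_self M a hx]
    norm_num
  · exact bilin_timeVector_ksFrameInvMap_basisVector_zero_neg hM a hx

end Literature.Geometry.Lorentzian.Kerr



end
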